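import Summits.MatrixMultiplication.OmegaCensus.SmallFormats.MatMul22nRankGF7Slack5Search
import HarnessLib

/-!
# ω-census family (a): replay of the slack-5 search certificate, CHECK B part 3 of 8 (classes `90 ≤ c < 212`)

Cell `pub-omega` (unit `pub-omega-tensor-g16`), topic `Summits/MatrixMultiplication/OmegaCensus` (sub-folder `SmallFormats`).
Framing (verbatim): lottery ticket; floor = certified bounds/negative ranges. HONEST FRAMING: machine-generated kernel replay
(`pub-omega-tensor-g16/code/gen5_runs.py`): `search5 c = true` for the classes `90 ≤ c < 212` (4446 search nodes in 3 `decide`s).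
Meaning (`search5_sound`, `MatMul22nRankGF7Slack5SearchSound`): no LP-tight point of slack 5 has one of these representatives as torus-0 column.
Nothing here is progress on `ω`.
-/

namespace Summit.MatrixMultiplication.OmegaCensus.SmallFormats

set_option Elab.async false

set_option maxRecDepth 100000 in
set_option maxHeartbeats 400000000 in
/-- Classes `90 ≤ c < 116` (1460 nodes). -/
theorem search5_ok_90_116 : ∀ c : Fin 656, 90 ≤ c.val → c.val < 116 → search5 c.val = true := by decide +kernel

set_option maxRecDepth 100000 in
set_option maxHeartbeats 400000000 in
/-- Classes `116 ≤ c < 167` (1499 nodes). -/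
theorem search5_ok_116_167 : ∀ c : Fin 656, 116 ≤ c.val → c.val < 167 → search5 c.val = true := by decide +kernel

set_option maxRecDepth 100000 in
set_option maxHeartbeats 400000000 in
/-- Classes `167 ≤ c < 212` (1487 nodes). -/
theorem search5_ok_167_212 : ∀ c : Fin 656, 167 ≤ c.val → c.val < 212 → search5 c.val = true := by decide +kernel

/-- CHECK B for the classes `90 ≤ c < 212`. -/
theorem search5_run_3 : ∀ c : Fin 656, 90 ≤ c.val → c.val < 212 → search5 c.val = true := by
  intro c hlo hhi
  by_cases h116 : c.val < 116
  · exact search5_ok_90_116 c (by omega) h116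
  by_cases h167 : c.val < 167
  · exact search5_ok_116_167 c (by omega) h167
  exact search5_ok_167_212 c (by omega) hhi

end Summit.MatrixMultiplication.OmegaCensus.SmallFormats
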